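import Literature.AlgebraicGeometry.Frobenioids.RlfStructure
import Literature.AlgebraicGeometry.Frobenioids.MonoidTransport
import HarnessLib

/-!
# Frobenioids I, Def. 2.4 (i): the primes of the realification `M^rlf`

Mochizuki, *The geometry of Frobenioids I*, Kyushu J. Math. **62** (2008), §2, Definition 2.4 (i),
kurims p. 48 [cite: MochizukiFrdI2008, Def. 2.4(i) p.48].  Second part of the proof of "`M^rlf`
[is] also perf-factorial" for a perf-factorial `M`:

* an element of `M^rlf` is primary iff its support is a single prime `𝔮 ∈ Prime(M^pf)`
  (`IsPerfFactorial.Rlf.isPrimary_iff`), using the archimedean property of the `ℝ`-monoprime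
  monoids `M^rlf_𝔮`;
* hence `Prime(M^rlf) ≅ Prime(M^pf)` (`IsPerfFactorial.Rlf.primesEquiv`), the submonoid `(M^rlf)_𝔮̃`
  generated by the prime `𝔮̃ ↔ 𝔮` is `{a | Supp(a) ⊆ {𝔮}}` and is isomorphic to `M^rlf_𝔮` via
  `a ↦ a_𝔮` (`submonoidEquivRlfAt`); in particular every `(M^rlf)_𝔮̃` is (`ℝ`-)monoprime —
  condition (b) of Def. 2.4 (i) for `M^rlf` (`IsPerfFactorial.Rlf.isMonoprime_submonoid`).

No statement of the paper is strengthened; multiplicative notation as in `Monoids.lean`.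
-/

noncomputable section

namespace Literature.AlgebraicGeometry.Frobenioids

namespace IsPerfFactorial

open Function

universe u

variable {M : Type u} [CommMonoid M] (h : IsPerfFactorial M)

namespace Rlf

/-- If `Supp(a) ⊆ {𝔮}` and `𝔮 ∈ Supp(b)` then `a ≼ b` in `M^rlf` (archimedean property of
`M^rlf_𝔮 ≅ ℝ_{≥0}`). [cite: MochizukiFrdI2008, Def. 2.4(i) p.48] -/
theorem precsim_of_supp (a b : h.Rlf) (𝔮 : Primes (Perfection M))
    (ha : supp (a : RlfFactor M) ⊆ {𝔮}) (hb : 𝔮 ∈ supp (b : RlfFactor M)) : a ≼ b := by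
  obtain ⟨n, hn, hdvd⟩ := exists_dvd_pow_of_isRMonoprime (h.isRMonoprime_rlfAt 𝔮)
    ((a : RlfFactor M) 𝔮) ((b : RlfFactor M) 𝔮) hb
  refine (precsim_iff h a b).mpr ⟨n, hn, fun 𝔮' => ?_⟩
  by_cases h𝔮 : 𝔮' = 𝔮
  · subst h𝔮
    exact hdvd
  · have : (a : RlfFactor M) 𝔮' = 1 := by
      by_contra hne
      exact h𝔮 (ha hne)
    rw [this]
    exact one_dvd _

/-- **An element of `M^rlf` is primary iff its support is a single prime.**
[cite: MochizukiFrdI2008, Def. 2.4(i) p.48] -/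
theorem isPrimary_iff (a : h.Rlf) : IsPrimary a ↔ ∃ 𝔮, supp (a : RlfFactor M) = {𝔮} := by
  constructor
  · intro ha
    obtain ⟨𝔮, h𝔮⟩ := (ne_one_iff_supp_nonempty h a).mp ha.1
    refine ⟨𝔮, Set.Subset.antisymm ?_ (Set.singleton_subset_iff.mpr h𝔮)⟩
    -- `restrict 𝔮 a ≼ a`, hence `a ≼ restrict 𝔮 a`, so `Supp(a) ⊆ {𝔮}`
    have hb1 : h.restrict 𝔮 a ≠ 1 := by
      intro h1
      have := congrArg (fun z : h.Rlf => (z : RlfFactor M) 𝔮) h1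
      simp only [coe_restrict, single'_apply_same, coe_one, Pi.one_apply] at this
      exact h𝔮 this
    have hba : h.restrict 𝔮 a ≼ a := Precsim.of_dvd (h.restrict_dvd 𝔮 a)
    exact (supp_subset_of_precsim h (ha.2 _ hb1 hba)).trans (h.supp_restrict_subset 𝔮 a)
  · rintro ⟨𝔮, h𝔮⟩
    refine ⟨(ne_one_iff_supp_nonempty h a).mpr ⟨𝔮, by rw [h𝔮]; rfl⟩, fun b hb hba => ?_⟩
    have hsb : supp (b : RlfFactor M) ⊆ {𝔮} := h𝔮 ▸ supp_subset_of_precsim h hba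
    obtain ⟨𝔮', h𝔮'⟩ := (ne_one_iff_supp_nonempty h b).mp hb
    have : 𝔮' = 𝔮 := hsb h𝔮'
    subst this
    exact precsim_of_supp h a b 𝔮' h𝔮.le h𝔮'

/-- Supports of `≼`-comparable primary elements coincide. [cite: MochizukiFrdI2008, Def. 2.4(i) p.48] -/
theorem supp_eq_of_precsim {a b : h.Rlf} (ha : IsPrimary a) (hb : IsPrimary b) (hab : a ≼ b) :
    supp (a : RlfFactor M) = supp (b : RlfFactor M) := by
  obtain ⟨𝔮a, h𝔮a⟩ := (isPrimary_iff h a).mp ha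
  obtain ⟨𝔮b, h𝔮b⟩ := (isPrimary_iff h b).mp hb
  have hsub := supp_subset_of_precsim h hab
  rw [h𝔮a, h𝔮b, Set.singleton_subset_singleton] at hsub
  rw [h𝔮a, h𝔮b, hsub]

/-- The prime of `M^pf` supporting a primary element of `M^rlf`. [cite: MochizukiFrdI2008, Def. 2.4(i) p.48] -/
def suppPrime (a : primaries h.Rlf) : Primes (Perfection M) :=
  Classical.choose ((isPrimary_iff h a.1).mp a.2)

/-- `Supp(a) = {suppPrime a}`. [cite: MochizukiFrdI2008, Def. 2.4(i) p.48] -/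
theorem supp_eq_suppPrime (a : primaries h.Rlf) : supp (a.1 : RlfFactor M) = {suppPrime h a} :=
  Classical.choose_spec ((isPrimary_iff h a.1).mp a.2)

/-- `Prime(M^rlf) → Prime(M^pf)`: the supporting prime of (any representative of) a class.
[cite: MochizukiFrdI2008, Def. 2.4(i) p.48] -/
def primeSupp : Primes h.Rlf → Primes (Perfection M) :=
  Quotient.lift (suppPrime h) fun a b hab => by
    have := supp_eq_of_precsim h a.2 b.2 hab
    rw [supp_eq_suppPrime, supp_eq_suppPrime, Set.singleton_eq_singleton_iff] at this
    exact this

/-- `primeSupp` on a class. [cite: MochizukiFrdI2008, Def. 2.4(i) p.48] -/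
theorem primeSupp_mk (a : h.Rlf) (ha : IsPrimary a) :
    supp (a : RlfFactor M) = {primeSupp h (Quotient.mk (primarySetoid h.Rlf) ⟨a, ha⟩)} :=
  supp_eq_suppPrime h ⟨a, ha⟩

/-- A chosen element of `M^pf` whose factorization is supported at `𝔮`. [cite: MochizukiFrdI2008, Def. 2.4(i) p.48] -/
def witness (h : IsPerfFactorial M) (𝔮 : Primes (Perfection M)) : Perfection M :=
  Classical.choose (h.exists_mem_supp_factorMap 𝔮)

/-- `𝔮 ∈ Supp(factorMap (witness 𝔮))`. [cite: MochizukiFrdI2008, Def. 2.4(i) p.48] -/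
theorem witness_spec (h : IsPerfFactorial M) (𝔮 : Primes (Perfection M)) :
    𝔮 ∈ supp (factorMap M (witness h 𝔮)) :=
  Classical.choose_spec (h.exists_mem_supp_factorMap 𝔮)

/-- A primary element of `M^rlf` supported exactly at `𝔮`. [cite: MochizukiFrdI2008, Def. 2.4(i) p.48] -/
def gen (𝔮 : Primes (Perfection M)) : h.Rlf := h.single 𝔮 (factorMap M (witness h 𝔮) 𝔮)

/-- `Supp(gen 𝔮) = {𝔮}`. [cite: MochizukiFrdI2008, Def. 2.4(i) p.48] -/
theorem supp_gen (𝔮 : Primes (Perfection M)) : supp (gen h 𝔮 : RlfFactor M) = {𝔮} := by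
  refine Set.Subset.antisymm (supp_single'_subset 𝔮 _) (Set.singleton_subset_iff.mpr ?_)
  show single' 𝔮 (factorMap M (witness h 𝔮) 𝔮) 𝔮 ≠ 1
  rw [single'_apply_same]
  exact witness_spec h 𝔮

/-- `gen 𝔮` is primary. [cite: MochizukiFrdI2008, Def. 2.4(i) p.48] -/
theorem isPrimary_gen (𝔮 : Primes (Perfection M)) : IsPrimary (gen h 𝔮) :=
  (isPrimary_iff h _).mpr ⟨𝔮, supp_gen h 𝔮⟩

/-- `Prime(M^pf) → Prime(M^rlf)`: the class of `gen 𝔮`. [cite: MochizukiFrdI2008, Def. 2.4(i) p.48] -/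
def primeOf (𝔮 : Primes (Perfection M)) : Primes h.Rlf :=
  Quotient.mk (primarySetoid h.Rlf) ⟨gen h 𝔮, isPrimary_gen h 𝔮⟩

/-- `primeSupp (primeOf 𝔮) = 𝔮`. [cite: MochizukiFrdI2008, Def. 2.4(i) p.48] -/
theorem primeSupp_primeOf (𝔮 : Primes (Perfection M)) : primeSupp h (primeOf h 𝔮) = 𝔮 := by
  have h1 := primeSupp_mk h (gen h 𝔮) (isPrimary_gen h 𝔮)
  rw [supp_gen, Set.singleton_eq_singleton_iff] at h1
  exact h1.symm

/-- `primeOf (primeSupp 𝔮̃) = 𝔮̃`. [cite: MochizukiFrdI2008, Def. 2.4(i) p.48] -/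
theorem primeOf_primeSupp (P : Primes h.Rlf) : primeOf h (primeSupp h P) = P := by
  induction P using Quotient.inductionOn with
  | h a =>
    apply Quotient.sound
    show gen h _ ≼ a.1
    have hsupp := supp_eq_suppPrime h a
    exact precsim_of_supp h _ _ _ (supp_gen h _).le (by rw [hsupp]; rfl)

/-- **`Prime(M^rlf) ≅ Prime(M^pf)`.** [cite: MochizukiFrdI2008, Def. 2.4(i) p.48] -/
def primesEquiv : Primes h.Rlf ≃ Primes (Perfection M) where
  toFun := primeSupp h
  invFun := primeOf h
  left_inv := primeOf_primeSupp h
  right_inv := primeSupp_primeOf h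

/-- The subset of the prime `primeOf 𝔮`: the elements supported exactly at `𝔮`.
[cite: MochizukiFrdI2008, Def. 2.4(i) p.48] -/
theorem mem_carrier_primeOf_iff (𝔮 : Primes (Perfection M)) (a : h.Rlf) :
    a ∈ (primeOf h 𝔮).carrier ↔ supp (a : RlfFactor M) = {𝔮} := by
  constructor
  · rintro ⟨ha, hP⟩
    rw [primeSupp_mk h a ha, hP, primeSupp_primeOf]
  · intro hs
    have ha : IsPrimary a := (isPrimary_iff h a).mpr ⟨𝔮, hs⟩
    refine ⟨ha, ?_⟩
    have h1 := primeSupp_mk h a ha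
    rw [hs, Set.singleton_eq_singleton_iff] at h1
    rw [← primeOf_primeSupp h (Quotient.mk (primarySetoid h.Rlf) ⟨a, ha⟩), ← h1]

/-- **The submonoid `(M^rlf)_𝔮̃` is `{a | Supp(a) ⊆ {𝔮}}`.** [cite: MochizukiFrdI2008, Def. 2.4(i) p.48] -/
theorem mem_submonoid_primeOf_iff (𝔮 : Primes (Perfection M)) (a : h.Rlf) :
    a ∈ (primeOf h 𝔮).submonoid ↔ supp (a : RlfFactor M) ⊆ {𝔮} := by
  constructor
  · intro ha
    induction ha using Submonoid.closure_induction with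
    | mem x hx => exact ((mem_carrier_primeOf_iff h 𝔮 x).mp hx).le
    | one => intro 𝔮' h𝔮'; exact (h𝔮' rfl).elim
    | mul x y _ _ hx hy =>
      rw [coe_mul]
      exact (supp_mul_subset _ _).trans (Set.union_subset hx hy)
  · intro hs
    by_cases ha : a = 1
    · rw [ha]; exact Submonoid.one_mem _
    · apply Submonoid.subset_closure
      rw [mem_carrier_primeOf_iff]
      obtain ⟨𝔮', h𝔮'⟩ := (ne_one_iff_supp_nonempty h a).mp ha
      have : 𝔮' = 𝔮 := hs h𝔮'
      subst this
      exact Set.Subset.antisymm hs (Set.singleton_subset_iff.mpr h𝔮')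

/-- **`(M^rlf)_𝔮̃ ≅ M^rlf_𝔮`**, `a ↦ a_𝔮` (for `𝔮̃ ↔ 𝔮`; stated with an equation to avoid index
transport). [cite: MochizukiFrdI2008, Def. 2.4(i) p.48] -/
def submonoidEquivRlfAt (P : Primes h.Rlf) (𝔮 : Primes (Perfection M)) (e : primeOf h 𝔮 = P) :
    ↥P.submonoid ≃* RlfAt M 𝔮 where
  toFun x := (x.1 : RlfFactor M) 𝔮
  invFun y := ⟨h.single 𝔮 y, by
    rw [← e, mem_submonoid_primeOf_iff]
    exact supp_single'_subset 𝔮 y⟩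
  left_inv x := by
    have hx : supp (x.1 : RlfFactor M) ⊆ {𝔮} := by
      rw [← mem_submonoid_primeOf_iff, e]; exact x.2
    apply Subtype.ext
    apply Subtype.ext
    funext 𝔮'
    show single' 𝔮 ((x.1 : RlfFactor M) 𝔮) 𝔮' = (x.1 : RlfFactor M) 𝔮'
    by_cases h𝔮 : 𝔮' = 𝔮
    · subst h𝔮
      exact single'_apply_same _ _
    · rw [single'_apply_of_ne h𝔮]
      by_contra hne
      exact h𝔮 (hx (Ne.symm hne))
  right_inv y := single'_apply_same 𝔮 y
  map_mul' x y := rfl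

/-- **Every `(M^rlf)_𝔮̃` is `ℝ`-monoprime** (it is `≅ M^rlf_𝔮`). [cite: MochizukiFrdI2008, Def. 2.4(i) p.48] -/
theorem isRMonoprime_submonoid (P : Primes h.Rlf) : IsRMonoprime ↥P.submonoid :=
  (h.isRMonoprime_rlfAt (primesEquiv h P)).of_mulEquiv
    (submonoidEquivRlfAt h P (primesEquiv h P) (primeOf_primeSupp h P)).symm

/-- Condition (b) of Def. 2.4 (i) for `M^rlf`: every `(M^rlf)_𝔮̃` is monoprime.
[cite: MochizukiFrdI2008, Def. 2.4(i) p.48] -/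
theorem isMonoprime_submonoid (P : Primes h.Rlf) : IsMonoprime ↥P.submonoid :=
  IsMonoprime.ofR (isRMonoprime_submonoid h P)

end Rlf

end IsPerfFactorial

end Literature.AlgebraicGeometry.Frobenioids
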